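import Summits.QuantumFields.YangMills.Theorems.BalabanUVNodesN16LeafSlot
import Summits.QuantumFields.YangMills.Theorems.BalabanUVNodesN16OfLeafRS
import HarnessLib

/-!
# Route «BalabanUVNodes», cluster K4 «SpineRates» — node N16 = NE3: THE LEAF-FORM SLOT FROM NODE N05's LEAF OF RECORD `B8LeafKnitRS.B8LeafRS` — the window threshold
# `c₁′` extracted from the leaf's `t4` ∕ `p3` thresholds (dag-n16-c `exists_window_print`), then `LeafSlot c` from the displayed letters at `c₁′` and N07's `LeafH3sup`

Cell `pub-ymgap`, seat `pub-ymgap-dag-n16-e` (R134 acceleration seat (a), strategy s2 = BY-NAME KNIT at the record; HUMAN RULING D-0062; chair R424 venue),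
generation 2, file 8 (THEOREMS ONLY, 0 `def`, 0 `sorry`).  `bears_on: R4∕N16 · edge N05 → N16 · K3′ SpineGivenEndpointR12`.  Filed `--supports stmt-QuantumFields-19792
--as helper`.  Imports this seat's file 7 `BalabanUVNodesN16LeafSlot` (`LeafSlot`) and dag-n16-c's file 6 `BalabanUVNodesN16OfLeafRS` (p465074; through it `B8LeafKnitRS.B8LeafRS`,
`N16.OfLeaf.exists_window_print`).  Restates nothing; cites by name.

WHY.  `LeafSlot c` (file 7) reads N05's leaf conjuncts as BODIES `B8.Thm4Body c₁ B₁′` ∕ `B8.Prop3Body cP …` at explicit thresholds and a window `c₁′` coordinated with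
them.  Node N05's statement OF RECORD is the surviving leaf `B8LeafRS d L C₂ B₁′ B₀′ B₁ B₂ c₁ inp B₀β loc fam lan cub toAxial` (NODE 00 binds `fam := fun i : IdxB8 θ ↦ zdGF3 …`),
whose fields `t4 : B8.Thm4Printed …` and `p3 : B8.Prop3Printed …` HIDE the thresholds existentially.  Exactly as dag-n16-c's `n16_of_b8LeafRS` does for N16's decl, this
file does it for the SLOT: the `∃ c₁′` comes FIRST (below both leaf thresholds, with `16·(5·4·c.L·B₀·c₁′) ≤ 1`), and only then are the averaging letter `α`, the class
radius `c.ε < α` and the other displayed lines chosen — so an instancer holding N05's record leaf at the all-torus sub-family of `zdGF3 (M_N ℂ) c.L 1 len` and N07's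
`LeafH3sup` meets `LeafSlot c` (hence `PrintSlot c`, hence `N16At c` under `InEndRegime c`, hence `S_N16` at any keyed home) by ONE theorem.

CONTENT.  `leafSlot_of_b8LeafRS` [folklore].

HONEST FRAMING.  Kernel bookkeeping by name; the leaf `B8LeafRS` on `zdGF3` at curved backgrounds is node N05's theorem (its `t4` ∕ `p3` are in the tree only modulo
n05-a's sockets; its `t2` ∕ `t8` are REFUTED off the univ sub-index — hence the sub-index); `LeafH3sup` = N07's [Balaban1985Variational] Thm 1 (8)+(10) TYPE; nothing of
Bałaban's asserted; **N16 ∕ NE3 NOT discharged**; count-neutral; one finite four-torus at fixed ε — NOT ℝ⁴, NOT infinite volume, NOT OS, NOT a mass gap, NOT Clay.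
-/

set_option autoImplicit false

open scoped BigOperators Matrix Matrix.Norms.L2Operator
open NormedSpace

namespace Summit.QuantumFields.YangMills.BalabanUVNodes.N16LeafSlotRS

open Literature.MathematicalPhysics.QuantumFieldTheory.Balaban1983to89
open B7Prop1Explicit B7Prop2Explicit
open B7Prop3Flat (c3)
open B8LeafModelZd (ZdIdx)
open B8LeafModelZd3 (zdGF3)
open B8LeafKnitRS (B8LeafRS)
open Summit.QuantumFields.BalabanUV.T4Continuum
open BlockAverageCurrent (curConst)
open NE3RightInverseSupLetters (frameC)
open NE3.LeafIndexSockets (LeafH3sup)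
open YMDAG.UVSplit (NE3Carriers)
open Summit.QuantumFields.YangMills.BalabanUVNodes.N16LeafSlot (LeafSlot)
open Summit.QuantumFields.YangMills.BalabanUVNodes.N16.OfLeaf (exists_window_print)

noncomputable section

/-! ## §1 From node N05's leaf of record to the leaf-form slot -/

/-- **FROM N05's LEAF OF RECORD TO THE LEAF-FORM SLOT** (`2 ≤ c.L`): node N05's surviving leaf `B8LeafRS 4 c.L C₂ B₁′ B₀′ B₁ B₂ c₁ inp B₀β loc fam lan cub toAxial` at
the family `fam := fun i : {i : ZdIdx 4 c.L // i.Ω 0 = univ} ↦ zdGF3 (M_N ℂ) c.L 1 len i.1` (only its fields `t4 : B8.Thm4Printed …` = `∃ c₁ > 0, Thm4Body …` and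
`p3 : B8.Prop3Printed …` = `∃ cP > 0, Prop3Body …` are read), with `len ≥ 1` on its support, `len e_μ = 1`, `0 < B₁′`, `5·4·c.L·B₀ ≤ B₁′`, YIELDS a window threshold
`c₁′ > 0` with `16·(5·4·c.L·B₀·c₁′) ≤ 1` (n16-c's `exists_window_print` below the two leaf thresholds) such that for ALL leaf letters `(b′, c′)`, averaging letter `α`,
(3.35) schedule `(Mc, 𝒬, C₃₃₅)` on `PrintSlot`'s displayed lines AT `c₁′` with `B := 5·4·c.L·B₀`, `B_h := 5·4·c.L·B₀β`, N07's `LeafH3sup 4 c.L c.Nper c.ε b′ c′ c.dom` gives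
`LeafSlot c`.  (The `∃ c₁′` precedes the choice of `α` and of `c.ε < α` — dag-n16-c `n16_of_b8LeafRS`'s order.)  So an instancer holding N05's record leaf at the all-torus
sub-family and N07's interface meets the slot by this one theorem. [folklore] -/
theorem leafSlot_of_b8LeafRS {N : ℕ} [NeZero N] (c : NE3Carriers N) (hL : 2 ≤ c.L) {I₁ I₃ I₄ : Type} {C₂ B₁' B₀' B₁ B₂ c₁ : ℝ} {inp : B8.B9Inputs}
    {B₀β : ℝ} {loc : I₁ → B8.LocalData} {lan : I₃ → B8.LandauData} {cub : I₄ → B8.CubeData} {len : Site 4 → ℝ}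
    {toAxial : letI : CStarAlgebra (Matrix (Fin N) (Fin N) ℂ) := {}
      ∀ i : {i : ZdIdx 4 c.L // i.Ω 0 = Set.univ},
        (zdGF3 (Matrix (Fin N) (Fin N) ℂ) c.L 1 len i.1).Cfg → (zdGF3 (Matrix (Fin N) (Fin N) ℂ) c.L 1 len i.1).Pert →
          (zdGF3 (Matrix (Fin N) (Fin N) ℂ) c.L 1 len i.1).Pert}
    (hlen : ∀ v : Site 4, 0 < len v → 1 ≤ len v) (hlen1 : ∀ μ : Fin 4, len (e μ) = 1) (hB₁' : 0 < B₁')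
    (hBB : 5 * ((4 : ℕ) : ℝ) * c.L * inp.B₀ ≤ B₁')
    (leaf : letI : CStarAlgebra (Matrix (Fin N) (Fin N) ℂ) := {}
      B8LeafRS 4 (c.L : ℝ) C₂ B₁' B₀' B₁ B₂ c₁ inp B₀β loc
        (fun i : {i : ZdIdx 4 c.L // i.Ω 0 = Set.univ} => zdGF3 (Matrix (Fin N) (Fin N) ℂ) c.L 1 len i.1) lan cub toAxial) :
    ∃ c₁' : ℝ, 0 < c₁' ∧ 16 * (5 * ((4 : ℕ) : ℝ) * c.L * inp.B₀ * c₁') ≤ 1 ∧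
      ∀ ⦃b' c' : ℝ⦄, 0 ≤ b' → 0 ≤ c' →
      2 ^ 15 * ((4 : ℝ) + 1) ^ 2 * ((4 : ℝ) + 4) ^ 2 * (c.L : ℝ) ^ 2 * b' ≤ 1 →
      23040 * (4 : ℝ) ^ 4 * (frameC 4 c.L + 4) ^ 3 * (c' + curConst 4 c.L * b' ^ 2) ≤ 1 →
      ∀ ⦃α : ℝ⦄, 0 < α → C0 4 * α ≤ 1 / 3 → 2 * α ≤ c2' 4 c.L → 11 * (4 : ℝ) ^ 2 * α ≤ 1 / 6 → α + 11 * (4 : ℝ) ^ 2 * α ≤ c₁' →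
      b' + 226 * (8 * ((4 : ℝ) + 1) * ((4 : ℝ) + 4)) ^ 2 * b' ^ 2 < α → 4 * ((4 : ℝ) - 1) * (c' + curConst 4 c.L * b' ^ 2) < α →
      ∀ ⦃Mc : ℝ⦄, 0 ≤ Mc → (Mc + 1) * (b' + 226 * (8 * ((4 : ℝ) + 1) * ((4 : ℝ) + 4)) ^ 2 * b' ^ 2) ≤ 1 / 2 →
      ∀ (𝒬 : ℕ → Set (Set (Site 4) × ℕ)), (∀ k, ∀ q ∈ 𝒬 k, q.2 ≤ k ∧ ∃ y : Site 4, ∀ z ∈ q.1, (l1 (z - y) : ℝ) ≤ Mc * (c.L : ℝ) ^ q.2) →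
      ∀ ⦃C335 : ℝ⦄, 2 * (Mc + 1) * (b' + 226 * (8 * ((4 : ℝ) + 1) * ((4 : ℝ) + 4)) ^ 2 * b' ^ 2) + 2 * Mc * (2 * (c' + curConst 4 c.L * b' ^ 2)) +
        4 * Mc * (1 + 2 * Mc) * (b' + 226 * (8 * ((4 : ℝ) + 1) * ((4 : ℝ) + 4)) ^ 2 * b' ^ 2) ^ 2 < C335 →
      c.ε < α → 5 * ((4 : ℕ) : ℝ) * c.L * inp.B₀ * (α + 11 * (4 : ℝ) ^ 2 * α) ≤ c.Λ₁ →
      5 * ((4 : ℕ) : ℝ) * c.L * inp.B₀ * (α + 11 * (4 : ℝ) ^ 2 * α) +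
          2 * (b' + 226 * (8 * ((4 : ℝ) + 1) * ((4 : ℝ) + 4)) ^ 2 * b' ^ 2) * c.Λ₁ ≤ c.Λ₁ →
      5 * ((4 : ℕ) : ℝ) * c.L * inp.B₀ * (α + 11 * (4 : ℝ) ^ 2 * α) + 16 * (b' + 226 * (8 * ((4 : ℝ) + 1) * ((4 : ℝ) + 4)) ^ 2 * b' ^ 2) *
          (5 * ((4 : ℕ) : ℝ) * c.L * inp.B₀ * (α + 11 * (4 : ℝ) ^ 2 * α)) ≤ c.Λ₁ →
      5 * ((4 : ℕ) : ℝ) * c.L * B₀β * (α + 11 * (4 : ℝ) ^ 2 * α) + 8 * (b' + 226 * (8 * ((4 : ℝ) + 1) * ((4 : ℝ) + 4)) ^ 2 * b' ^ 2) *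
          (5 * ((4 : ℕ) : ℝ) * c.L * inp.B₀ * (α + 11 * (4 : ℝ) ^ 2 * α)) ≤ c.Λ₂' →
      LeafH3sup 4 c.L c.Nper c.ε b' c' c.dom → LeafSlot c := by
  letI : CStarAlgebra (Matrix (Fin N) (Fin N) ℂ) := {}
  -- the two thresholds of the leaf's `t4` ∕ `p3`, and the window threshold below them
  obtain ⟨c₁t, hc₁t, hT⟩ := leaf.t4
  obtain ⟨cP, hcP, hP⟩ := leaf.p3
  obtain ⟨c₁', hc₁', hwin⟩ := exists_window_print (d := 4) (L := c.L) (by norm_num) hL C₂ hc₁t hcP hB₁'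
  have h16 : 16 * (5 * ((4 : ℕ) : ℝ) * c.L * inp.B₀ * c₁') ≤ 1 := by
    obtain ⟨-, -, -, h, -⟩ := hwin (c₁' / 2) (c₁' / 2) (by linarith) (by linarith) (by linarith)
    have h' : 16 * (B₁' * c₁') ≤ 1 := by rwa [add_halves] at h
    nlinarith [mul_le_mul_of_nonneg_right hBB hc₁'.le]
  refine ⟨c₁', hc₁', h16, fun b' c' hb' hc' hRb hcF α hα hA3 hA2 hAs hAc hb'α hc'α Mc hMc hMcα 𝒬 h𝒬 C335 hC335 hεα hss hgrad hℓ hhol h3 => ?_⟩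
  exact ⟨len, c₁t, c₁', B₁', cP, C₂, B₀β, inp, 5 * ((4 : ℕ) : ℝ) * c.L * inp.B₀, 5 * ((4 : ℕ) : ℝ) * c.L * B₀β, b', c', α, Mc, C335, 𝒬, hlen, hlen1,
    hB₁', hBB, rfl, rfl, by linarith [h16], hwin, hb', hc', hRb, hcF, hα, hA3, hA2, hAs, hAc, hb'α, hc'α, hMc, hMcα, h𝒬, hC335, hεα, hss, hgrad, hℓ,
    hhol, hT, hP, h3⟩

end

end Summit.QuantumFields.YangMills.BalabanUVNodes.N16LeafSlotRS
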